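import Summits.BirchSwinnertonDyer.BirchSwinnertonDyer.Theorems.EisensteinPrimesKatzLineIntFrameOfTeichmuller
import Summits.BirchSwinnertonDyer.BirchSwinnertonDyer.Theorems.EisensteinPrimesResidualPairFromRat
import HarnessLib

/-!
# AN-F₁ in the K-level currency of the line (`KatzLineIntFrameAt` of idea-11's split, token for token
# up to unfolding `IsKatzLFunctionInt` / `IntFirstUnitCoeffAt`), GRANTED de Shalit II.6.4
# (helper file for crux 2 `GoodLatticeBDPValue`, stmt-BirchSwinnertonDyer-19032, line `halves`, stub 3
# `stub_anDS`; seat `bsd-line-x1-p1-w2` gen 2)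

`…KatzLineIntFrameOfTeichmuller.katzLineIntFrame_of_teichmullerPair` proves AN-F₁ for the Teichmüller pair
OVER `ℚ`; the registered stub `stub_anDS` and the idea file `Lines/halves_anDS_split_idea11g4.lean` carry a
K-LEVEL residual pair `IsResidualPairOver (W.baseChange K) p θsub θquot`. The bridge
`ResidualLineRigidity.residualPair_eq_restrictField` (every K-level residual pair IS the restricted
ℚ-Teichmüller pair, under `2 < p`, `Anom`, no unramified rational `p`-line, `K` imaginary quadratic)
closes the gap: `katzLineIntFrame_of_residualPair` below has EXACTLY the binders of `KatzLineIntFrameAt W p`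
(preceded by the PUBLISHED named fact `thmII64_katzMeasure₂_functionalEquation` as a hypothesis) and its
conclusion with the two idea-file predicates unfolded. A LEAD who registers
`stub_katzLineIntFrame : thmII64_katzMeasure₂_functionalEquation → ∀ W p, KatzLineIntFrameAt W p`
closes it by `fun hF W _ _ p _ ↦ katzLineIntFrame_of_residualPair hF W p` (up to `Iff.rfl` unfolding).
No definition, no `sorry`; nothing about BSD, IMC2 or KY Thm. 3.0.8 is proved.
-/

-- the summit namespace `Summit.BirchSwinnertonDyer.BirchSwinnertonDyer` repeats the problem name by design (D-0017)
set_option linter.dupNamespace false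
set_option autoImplicit false

noncomputable section

open scoped Classical Topology

open Filter WeierstrassCurve NumberField IsDedekindDomain Field PowerSeries
  Literature.NumberTheory.EllipticCurves Literature.NumberTheory.EllipticCurves.Rank1Residual
  Literature.NumberTheory.GaloisRepresentations Literature.NumberTheory.GaloisRepresentations.HeckeCharacter
  Literature.NumberTheory.Automorphic Literature.NumberTheory.QuadraticFields
  Literature.NumberTheory.EllipticCurves.CastellaGrossiLeeSkinner2022
  Literature.NumberTheory.EllipticCurves.KellerYin2024
  Literature.NumberTheory.EllipticCurves.Rubin1991 Literature.NumberTheory.EllipticCurves.DeShalit1987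
  Summit.BirchSwinnertonDyer.Rank1Residual.X11b
  Summit.BirchSwinnertonDyer.BirchSwinnertonDyer.Theorems.EisensteinPrimesMuLambda
  Summit.BirchSwinnertonDyer.BirchSwinnertonDyer.Theorems.ResidualLineRigidity

namespace Summit.BirchSwinnertonDyer.BirchSwinnertonDyer.Theorems.KatzLineFrame

/-- **AN-F₁, K-level currency** — the statement of the idea file's `KatzLineIntFrameAt W p` (binders
token for token, conclusion unfolded), granted de Shalit II.6.4 (`hF`): composition of the K-to-ℚ bridge
`residualPair_eq_restrictField` (the given residual pair over `K` is the restricted Teichmüller pair of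
`exists_teichmullerPair`) with `katzLineIntFrame_of_teichmullerPair`.
[cite: deShalit1987, II.6.4 Theorem (i) (9), (14)–(15); II.4.16 (49)–(50)]
[cite: CastellaGrossiLeeSkinner2022, Thm. 2.1.2 (arXiv:2008.02571v2 TeX L1015–1041)]
[cite: KellerYin2024, §1.4 and Thms. 2.2.1–2.2.2 (arXiv:2402.12781v2 TeX L1063–1086, L1426–1448)] -/
theorem katzLineIntFrame_of_residualPair (hF : thmII64_katzMeasure₂_functionalEquation)
    (W : WeierstrassCurve ℚ) [W.IsElliptic] [W.IsGloballyMinimal] (p : ℕ) [Fact p.Prime] :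
    2 < p → Good W p → Red W p → Anom W p →
    (∀ Φ : AddSubgroup (geomTorsion W (p : ℤ)), IsRationalLine W p Φ → ¬ LineUnramifiedAt W p Φ) →
    ∀ (K : Type) [Field K] [NumberField K], IsImaginaryQuadratic K →
      SatisfiesHeegnerHypothesis (W.conductorNorm ℤ) K → SatisfiesHeegnerHypothesis p K →
      Odd (NumberField.discr K) → NumberField.discr K ≠ -3 →
    ∀ (ι : K →+* ℚ_[p]) (v vbar : HeightOneSpectrum (𝓞 K)),
      (∀ x : 𝓞 K, x ∈ v.asIdeal ↔ ‖ι (x : K)‖ < 1) →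
      ((p : ℕ) : 𝓞 K) ∈ vbar.asIdeal → vbar ≠ v →
    ∀ (κ : ZpExtension K p), κ.IsAnticyclotomic →
    ∀ (γ : absoluteGaloisGroup K) [Fact (κ.IsTopGenerator γ)],
    ∀ (ι' : PadicAlgCl p ≃+* ℂ),
      (∀ (w : InfinitePlace K) (k : 𝓞 K), k ∈ v.asIdeal ↔ ‖ι'.symm (w.embedding (k : K))‖ < 1) →
    ∀ (θsub θquot : FramedGaloisRep K (padicCoeffIntegers (∅ : Set (PadicAlgCl p))) 1),
      IsResidualPairOver (W.baseChange K) p θsub θquot →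
    ∀ (θK : HeckeCharacter K), IsHeckeCharOf ι' θquot θK →
    ∀ (S : Finset (HeightOneSpectrum (𝓞 K))),
      (∀ w : HeightOneSpectrum (𝓞 K), w ∈ S ↔ ¬ θK.IsUnramifiedAt w) →
    ∀ (κ' : ZpExtension K p) (γ' : absoluteGaloisGroup K), ZpExtension.IsTopGeneratorPair κ κ' γ γ' →
    ∀ (Ω δ : ℂ) (Ωp : (unrIntegers p)ˣ) (G : PowerSeries (PowerSeries (PadicComplexInt p)))
      (g : IwasawaAlgebra₂ p), Ω ≠ 0 →
      (δ ^ 2 = (NumberField.discr K : ℂ) ∨ δ ^ 2 = -(NumberField.discr K : ℂ)) →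
      IsKatzMeasure₂ ι' v vbar S κ κ' γ⁻¹ γ'⁻¹ θK⁻¹ Ω δ ((Ωp : unrIntegers p) : ℂ_[p]) G →
      (∀ (J : ℤ_[p] →+* PadicComplexInt p),
        (∀ x : ℤ_[p], ((J x : PadicComplexInt p) : ℂ_[p]) = ((x : ℚ_[p]) : ℂ_[p])) →
        Associated (PowerSeries.map (PowerSeries.map J) g) G) →
      (g.map (PowerSeries.constantCoeff (R := ℤ_[p]))).map (IsLocalRing.residue ℤ_[p]) ≠ 0 →
    ∃ (ΩK' : ℂ) (Ωp' : ℂ_[p]) (Q : PowerSeries 𝓞_ℂ_[p]), ΩK' ≠ 0 ∧ ‖Ωp'‖ = 1 ∧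
      (∀ (φ : HeckeCharacter K) (n : ℕ), 0 < n → (p - 1) ∣ n →
        (∀ w : HeightOneSpectrum (𝓞 K), φ.IsUnramifiedAt w) →
        φ.HasInfinityType (fun _ ↦ (n : ℤ)) (fun _ ↦ -(n : ℤ)) →
        ∀ (hL : LFunction.HasEntireContinuation (heckeLFunction (θK * φ))),
        ∀ r : FramedGaloisRep K (PadicAlgCl p) 1, IsPAdicAvatarOf ι' φ r → FactorsThroughZp κ r →
          IntSeries.HasValueAt Q (avatarValueAt r γ - 1)
            (((ι'.symm (katzInterpolationValue p θK v vbar ∅ φ n ΩK' (hL.continuation 1)) :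
                PadicAlgCl p) : ℂ_[p]) * Ωp' ^ (2 * n))) ∧
      (‖((PowerSeries.coeff ((g.map (PowerSeries.constantCoeff (R := ℤ_[p]))).map
            (IsLocalRing.residue ℤ_[p])).order.toNat Q : 𝓞_ℂ_[p]) : ℂ_[p])‖ = 1 ∧
        ∀ i < ((g.map (PowerSeries.constantCoeff (R := ℤ_[p]))).map
            (IsLocalRing.residue ℤ_[p])).order.toNat,
          ‖((PowerSeries.coeff i Q : 𝓞_ℂ_[p]) : ℂ_[p])‖ < 1) := by
  intro hp hgood hred hanom hGL K _ _ hK hHN hHp hodd h3 ι v vbar hιv hvbar hne κ hκ γ hγ ι' hι' θsub θquot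
    hpair θK hθK S hS κ' γ' hgen Ω δ Ωp G g hΩ hδ hG hJ hg0
  have hp2 : p ≠ 2 := by omega
  obtain ⟨Φ₀, hΦ₀, θsub₀, θquot₀, hsub₀, hquot₀⟩ := exists_teichmullerPair W p hred
  obtain ⟨-, hq⟩ := residualPair_eq_restrictField W p K hp2 hanom hGL hK hΦ₀ hsub₀ hquot₀ hpair
  subst hq
  exact katzLineIntFrame_of_teichmullerPair hF W p hp hgood hred hanom hGL K hK hHN hHp hodd h3 ι v vbar
    hιv hvbar hne κ hκ γ ι' hι' Φ₀ hΦ₀ θsub₀ θquot₀ hsub₀ hquot₀ θK hθK S hS κ' γ' hgen Ω δ Ωp G g hΩ hδ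
    hG hJ hg0

/-- **The Hecke character of the quotient character of ANY residual pair over `K` is of finite order,
`c`-invariant and unramified above `p`** (K-level currency of
`heckeCharOf_quotChar_finiteOrder_galConj_unramified`, through the bridge `residualPair_eq_restrictField`):
the three displayed hypotheses of `exists_katzLineIntFrame`, for the data of the line's stubs.
[cite: CasselsFrohlichANT1967, Ch. VII §5.1 and §4 Prop. 4.1] [cite: KellerYin2024, §1.4 (arXiv:2402.12781v2 TeX L1063–1086)] -/
theorem heckeCharOf_residualPair_finiteOrder_galConj_unramified (W : WeierstrassCurve ℚ) [W.IsElliptic]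
    [W.IsGloballyMinimal] (p : ℕ) [Fact p.Prime] (hp : 2 < p) (hgood : Good W p) (hred : Red W p)
    (hanom : Anom W p)
    (hGL : ∀ Φ : AddSubgroup (geomTorsion W (p : ℤ)), IsRationalLine W p Φ → ¬ LineUnramifiedAt W p Φ)
    {K : Type} [Field K] [NumberField K] [IsCMField K] (hK : IsImaginaryQuadratic K)
    (ι' : PadicAlgCl p ≃+* ℂ)
    {θsub θquot : FramedGaloisRep K (padicCoeffIntegers (∅ : Set (PadicAlgCl p))) 1}
    (hpair : IsResidualPairOver (W.baseChange K) p θsub θquot)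
    {θK : HeckeCharacter K} (hθK : IsHeckeCharOf ι' θquot θK) :
    θK.IsFiniteOrder ∧ HeckeCharacter.galConj (IsCMField.complexConj K) θK = θK ∧
      ∀ w : HeightOneSpectrum (𝓞 K), ((p : ℕ) : 𝓞 K) ∈ w.asIdeal → θK.IsUnramifiedAt w := by
  have hp2 : p ≠ 2 := by omega
  obtain ⟨Φ₀, hΦ₀, θsub₀, θquot₀, hsub₀, hquot₀⟩ := exists_teichmullerPair W p hred
  obtain ⟨-, hq⟩ := residualPair_eq_restrictField W p K hp2 hanom hGL hK hΦ₀ hsub₀ hquot₀ hpair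
  subst hq
  exact heckeCharOf_quotChar_finiteOrder_galConj_unramified W p hp hgood hred hanom hGL ι' hΦ₀ hquot₀ hθK

end Summit.BirchSwinnertonDyer.BirchSwinnertonDyer.Theorems.KatzLineFrame

end
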